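import Summits.Ventures.PercRepro.S1RankProfileDoubleCountAll
import Summits.Ventures.PercRepro.S1EightFiveFiveThree

/-!
# PercRepro — THE `(3, 5)` SPLIT AT `(8, 4)`: A SIMPLE COLOOP-FREE RANK-3 PART ON 6 POINTS ⊕ A SIMPLE COLOOP-FREE
RANK-5 PART ON 7 POINTS (p2, gen 28; SUBCLAIM-S1 §6.10 (xvii)(l))

`#U ≤ 25 N_N(5, 2) + 140` (`N_M(3, 2) ≤ 25` by the triple incidence count of `S1DisjointSumThreeSixProfile`,
`N_M(3, 3) ≤ 20`, `N_N(5, 1) ≤ 7`), Theorem N at `(5, 2)` on `N` (`N_N(5, 2) ≤ (3/10)(f_N(3) + f_N(4))`), and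
`#Y ≥ 659 + 38 (f_N(3) + f_N(4)) + 6 f_N(4)` with `f_N(4) ≥ 14` (the `3`-sets of rank `3` number `≥ 35 − 7` — at
most `7` rank-`2` triples since the closure of a pair has `≤ 3` points — and the level double count
`2 f_N(3) ≤ 4 f_N(4)`): `Φ(8, 4) · #U ≤ 38 T + 709.4 ≤ 38 T + 743 ≤ #Y`. Nothing is claimed about any cell.

* `ncard_rankSet_three_ge_rank_five_seven`, `ncard_rankSet_four_ge_rank_five_seven`;
* `c025_eight_four_disjointSum_three_five`.
Axioms: standard.
-/

open scoped Matroid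

namespace PercRepro

namespace S1

open Set

variable {α : Type}

/-- `f(3) ≥ 28` for a coloop-free matroid of rank `5` on `7` points with all pairs of rank `2`: at most `7` of
the `35` three-sets are rank-`2` triples. -/
theorem ncard_rankSet_three_ge_rank_five_seven (N : Matroid α) [N.Finite] (hN : N.eRank = ((5 : ℕ) : ℕ∞))
    (hE : N.E.ncard = 7) (hcol : N.coloops = ∅) (hpairs : ∀ e ∈ N.E, ∀ f ∈ N.E, e ≠ f → N.eRk {e, f} = 2) :
    28 ≤ (rankSet N 3).ncard := by
  have hcl : ∀ x ∈ N.E, ∀ y ∈ N.E, x ≠ y → (N.closure {x, y}).ncard ≤ 1 + 2 := by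
    intro x hx y hy hxy
    have := ncard_closure_pair_le_of_coloops' N hN (by norm_num) hcol hpairs hx hy hxy
    rw [hE] at this
    omega
  have ht := three_mul_ncard_rankTwoTriples_le_of_closure N hpairs hcl
  rw [hE, show Nat.choose 7 2 = 21 by decide] at ht
  have hfin3 : {A : Set α | A ⊆ N.E ∧ A.ncard = 3}.Finite := N.ground_finite.finite_subsets.subset (fun _ hA => hA.1)
  have hTsub : rankTwoTriples N ⊆ {A : Set α | A ⊆ N.E ∧ A.ncard = 3} := fun T hT => ⟨hT.1, hT.2.1⟩
  have hsub : {A : Set α | A ⊆ N.E ∧ A.ncard = 3} \ rankTwoTriples N ⊆ rankSet N 3 := by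
    rintro A ⟨⟨hAE, hA3⟩, hAT⟩
    refine ⟨hAE, ?_⟩
    have hhi : N.eRk A ≤ 3 := by
      have := N.eRk_le_encard A
      rwa [← (N.ground_finite.subset hAE).cast_ncard_eq, hA3] at this
    have hlo := two_le_eRk_of_two_le_ncard hpairs hAE (by omega)
    obtain ⟨n, hn⟩ := ENat.ne_top_iff_exists.mp (ne_top_of_le_ne_top (by decide) hhi)
    rw [← hn] at hlo hhi ⊢
    have hlo' : 2 ≤ n := by exact_mod_cast hlo
    have hhi' : n ≤ 3 := by exact_mod_cast hhi
    rcases Nat.lt_or_ge n 3 with h | h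
    · exfalso
      apply hAT
      refine ⟨hAE, hA3, ?_⟩
      rw [← hn]
      have : n = 2 := by omega
      rw [this]; rfl
    · have : n = 3 := by omega
      rw [this]
  have h := ncard_le_ncard hsub (rankSet_finite N 3)
  rw [ncard_sdiff hTsub (rankTwoTriples_finite N), ncard_setOf_subset_ncard_eq N.ground_finite 3, hE] at h
  have h73 : Nat.choose 7 3 = 35 := by decide
  have hT7 : (rankTwoTriples N).ncard ≤ 7 := by omega
  omega

/-- `f(4) ≥ 14` for a coloop-free matroid of rank `5` on `7` points with all pairs of rank `2`: the level double
count `2 f(3) ≤ 4 f(4)` and `f(3) ≥ 28`. -/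
theorem ncard_rankSet_four_ge_rank_five_seven (N : Matroid α) [N.Finite] (hN : N.eRank = ((5 : ℕ) : ℕ∞))
    (hE : N.E.ncard = 7) (hcol : N.coloops = ∅) (hpairs : ∀ e ∈ N.E, ∀ f ∈ N.E, e ≠ f → N.eRk {e, f} = 2) :
    14 ≤ (rankSet N 4).ncard := by
  have h3 := ncard_rankSet_three_ge_rank_five_seven N hN hE hcol hpairs
  have hdc : (5 - 3) * (rankSet N 3).ncard ≤ (3 + 1) * (rankSet N (3 + 1)).ncard :=
    sub_mul_ncard_rankSet_le N hN 3
  have hdc' : 2 * (rankSet N 3).ncard ≤ 4 * (rankSet N 4).ncard := hdc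
  omega

/-- The arithmetic of the `(3, 5)`-split consumer at `(8, 4)`. -/
theorem consumer_arith_three_five_eight {u y P T f4 : ℚ} (hU : u ≤ 25 * P + 140) (h52 : 10 / 3 * P ≤ T)
    (hY : 659 + 38 * T + 6 * f4 ≤ y) (hf4 : 14 ≤ f4) : 76 / 15 * u ≤ y := by
  linarith

/-- **The `(3, 5)`-split consumer at `(8, 4)`**: `M` coloop-free of rank `3` on `6` points and `N` coloop-free of
rank `5` on `7` points, both with all pairs of rank `2`. -/
theorem c025_eight_four_disjointSum_three_five (M N : Matroid α) [M.Finite] [N.Finite] (h : Disjoint M.E N.E)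
    (hM : M.eRank = ((3 : ℕ) : ℕ∞)) (hME : M.E.ncard = 6) (hcolM : M.coloops = ∅)
    (hpairsM : ∀ e ∈ M.E, ∀ f ∈ M.E, e ≠ f → M.eRk {e, f} = 2) (hN : N.eRank = ((5 : ℕ) : ℕ∞))
    (hNE : N.E.ncard = 7) (hcolN : N.coloops = ∅) (hpairsN : ∀ e ∈ N.E, ∀ f ∈ N.E, e ≠ f → N.eRk {e, f} = 2) :
    phiK 8 4 * ({A : Set α | A ⊆ (M.disjointSum N h).E ∧ (M.disjointSum N h).eRk A = ((8 : ℕ) : ℕ∞) ∧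
        (M.disjointSum N h).eRk ((M.disjointSum N h).E \ A) = ((4 : ℕ) : ℕ∞)}.ncard : ℚ) ≤
      ({A : Set α | A ⊆ (M.disjointSum N h).E ∧ ((4 : ℕ) : ℕ∞) < (M.disjointSum N h).eRk A ∧
        (M.disjointSum N h).eRk A < ((8 : ℕ) : ℕ∞)}.ncard : ℚ) := by
  -- the `U`-side
  have hU : {A : Set α | A ⊆ (M.disjointSum N h).E ∧ (M.disjointSum N h).eRk A = ((8 : ℕ) : ℕ∞) ∧
      (M.disjointSum N h).eRk ((M.disjointSum N h).E \ A) = ((4 : ℕ) : ℕ∞)}.ncard ≤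
      25 * (profileSet N 5 2).ncard + 140 := by
    rw [disjointSum_ncard_U_eq_finsum M N h 8 4, finsum_mem_coe_finset]
    rw [Finset.sum_eq_add_of_mem (3, 2) (3, 3) (by decide) (by decide) (by decide) ?_]
    · dsimp only
      show (profileSet M 3 2).ncard * (profileSet N 5 2).ncard + (profileSet M 3 3).ncard * (profileSet N 5 1).ncard ≤ _
      have hT := three_mul_ncard_rankTwoTriples_le hM hcolM hpairsM hME
      have h32 := ncard_profileSet_three_two_le_add (M := M) hME
      have h32' : (profileSet M 3 2).ncard ≤ 25 := by omega
      have h33 := ncard_profileSet_le_choose_of_ncard_eq (N := M) (a := 3) (b := 3) hME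
      rw [show Nat.choose (3 + 3) 3 = 20 by decide] at h33
      have h51 := ncard_profileSet_top_one_le_of_pairs' hpairsN 5
      rw [hNE] at h51
      calc (profileSet M 3 2).ncard * (profileSet N 5 2).ncard + (profileSet M 3 3).ncard * (profileSet N 5 1).ncard
          ≤ 25 * (profileSet N 5 2).ncard + 20 * 7 :=
            Nat.add_le_add (Nat.mul_le_mul_right _ h32') (Nat.mul_le_mul h33 h51)
        _ = 25 * (profileSet N 5 2).ncard + 140 := by ring
    · rintro ⟨a, b⟩ hmem ⟨hne1, hne2⟩
      rw [Finset.mem_product, Finset.mem_range, Finset.mem_range] at hmem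
      dsimp only
      rcases Nat.lt_or_ge 3 a with ha | ha
      · rw [profileSet_eq_empty_of_eRank_lt M hM ha b, ncard_empty, zero_mul]
      rcases Nat.lt_or_ge a 3 with ha' | ha'
      · have h8a : 5 < 8 - a := by omega
        rw [profileSet_eq_empty_of_eRank_lt N hN h8a (4 - b), ncard_empty, mul_zero]
      have ha3 : a = 3 := by omega
      subst ha3
      rw [show (8 : ℕ) - 3 = 5 from rfl]
      rcases Nat.lt_or_ge b 2 with hb | hb
      · have h7 : N.E.ncard < 5 + (4 - b) := by rw [hNE]; omega
        rw [profileSet_eq_empty_of_ncard_lt N h7, ncard_empty, mul_zero]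
      · have hb4 : b = 4 := by
          rcases Nat.lt_or_ge b 4 with hb4 | hb4
          · exfalso
            rcases Nat.lt_or_ge b 3 with hb3 | hb3
            · exact hne1 (by congr 1; omega)
            · exact hne2 (by congr 1; omega)
          · omega
        subst hb4
        rw [profileSet_eq_empty_of_eRank_lt_snd M hM (by norm_num) 3, ncard_empty, zero_mul]
  -- the `Y`-side
  have hY : 659 + 38 * ((rankSet N 3).ncard + (rankSet N 4).ncard) + 6 * (rankSet N 4).ncard ≤
      {A : Set α | A ⊆ (M.disjointSum N h).E ∧ ((4 : ℕ) : ℕ∞) < (M.disjointSum N h).eRk A ∧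
        (M.disjointSum N h).eRk A < ((8 : ℕ) : ℕ∞)}.ncard := by
    rw [disjointSum_ncard_Y_eq_finsum M N h 8 4, finsum_mem_coe_finset]
    have hsub : ({(0, 5), (1, 4), (1, 5), (2, 3), (2, 4), (2, 5), (3, 2), (3, 3), (3, 4)} : Finset (ℕ × ℕ)) ⊆
        (Finset.range 8 ×ˢ Finset.range 8).filter (fun x : ℕ × ℕ => 4 < x.1 + x.2 ∧ x.1 + x.2 < 8) := by
      decide
    refine le_trans ?_ (Finset.sum_le_sum_of_subset hsub)
    rw [Finset.sum_insert (by decide), Finset.sum_insert (by decide), Finset.sum_insert (by decide),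
      Finset.sum_insert (by decide), Finset.sum_insert (by decide), Finset.sum_insert (by decide),
      Finset.sum_insert (by decide), Finset.sum_insert (by decide), Finset.sum_singleton]
    dsimp only
    have F3 := ncard_rankSet_three_ge_of_pairs hM hcolM hpairsM hME
    have F2 : 15 ≤ (rankSet M 2).ncard := by
      have := choose_le_ncard_rankSet_two_of_pairs hpairsM
      rwa [hME, show Nat.choose 6 2 = 15 by decide] at this
    have F1 : 6 ≤ (rankSet M 1).ncard := by
      have := ncard_le_ncard_rankSet_one_of_pairs hpairsM (by omega)
      rwa [hME] at this
    have F0 : 1 ≤ (rankSet M 0).ncard := by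
      have h0 : (∅ : Set α) ∈ rankSet M 0 := ⟨empty_subset _, by rw [M.eRk_empty]; rfl⟩
      exact (ncard_pos (rankSet_finite M 0)).mpr ⟨∅, h0⟩
    have G2 : 21 ≤ (rankSet N 2).ncard := by
      have := choose_le_ncard_rankSet_two_of_pairs hpairsN
      rwa [hNE, show Nat.choose 7 2 = 21 by decide] at this
    have G5 : 8 ≤ (rankSet N 5).ncard := by
      have := succ_le_ncard_rankSet_top_of_coloops N hN hcolN
      rwa [hNE] at this
    have e05 := Nat.mul_le_mul F0 G5
    have e14 := Nat.mul_le_mul_right (rankSet N 4).ncard F1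
    have e15 := Nat.mul_le_mul F1 G5
    have e23 := Nat.mul_le_mul_right (rankSet N 3).ncard F2
    have e24 := Nat.mul_le_mul_right (rankSet N 4).ncard F2
    have e25 := Nat.mul_le_mul F2 G5
    have e32 := Nat.mul_le_mul F3 G2
    have e33 := Nat.mul_le_mul_right (rankSet N 3).ncard F3
    have e34 := Nat.mul_le_mul_right (rankSet N 4).ncard F3
    linarith
  -- Theorem N at `(5, 2)` on `N`
  have h52 : (10 / 3 : ℚ) * ((profileSet N 5 2).ncard : ℚ) ≤
      ((rankSet N 3).ncard : ℚ) + ((rankSet N 4).ncard : ℚ) := by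
    have h0 := ThmN.c025_two_all N 5 (by norm_num)
    unfold ThmN.RLS at h0
    rw [phiK_five_two, ySet_eq_rankSet_union_of_eq N (q := 2) (p := 5) (k := 3) (k' := 4) rfl rfl rfl,
      ncard_union_eq (rankSet_disjoint_of_ne N (by norm_num)) (rankSet_finite N 3) (rankSet_finite N 4)] at h0
    push_cast at h0
    exact h0
  have hf4 := ncard_rankSet_four_ge_rank_five_seven N hN hNE hcolN hpairsN
  rw [phiK_eight_four]
  have hU' : (({A : Set α | A ⊆ (M.disjointSum N h).E ∧ (M.disjointSum N h).eRk A = ((8 : ℕ) : ℕ∞) ∧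
      (M.disjointSum N h).eRk ((M.disjointSum N h).E \ A) = ((4 : ℕ) : ℕ∞)}.ncard : ℕ) : ℚ) ≤
      25 * ((profileSet N 5 2).ncard : ℚ) + 140 := by
    exact_mod_cast hU
  have hY' : 659 + 38 * (((rankSet N 3).ncard : ℚ) + ((rankSet N 4).ncard : ℚ)) + 6 * ((rankSet N 4).ncard : ℚ) ≤
      (({A : Set α | A ⊆ (M.disjointSum N h).E ∧ ((4 : ℕ) : ℕ∞) < (M.disjointSum N h).eRk A ∧
        (M.disjointSum N h).eRk A < ((8 : ℕ) : ℕ∞)}.ncard : ℕ) : ℚ) := by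
    exact_mod_cast hY
  have hf4' : (14 : ℚ) ≤ ((rankSet N 4).ncard : ℚ) := by exact_mod_cast hf4
  exact consumer_arith_three_five_eight hU' h52 hY' hf4'

end S1

end PercRepro
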